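import Summits.NavierStokesRegularity.NavierStokesRegularity.Theorems.ScenarioCensusTemporalSpectrumComplexRow
import Summits.NavierStokesRegularity.NavierStokesRegularity.Theorems.ScenarioCensusModeRankShell
import HarnessLib

/-!
# LINE «temporal-spectrum» port, part 9/12: §Q (b) — `hasDerivAt_csT`, the `q` bookkeeping, `q_decay`, `q_identity`, `qX` / `qY`

Re-homed for the scenario census (typer seat ns-census-typer-1 g8; the cells A1ex / A1po are MEMBERS OF RECORD «DECIDED IN KERNEL IN FILES» of row A1apT since census
v1.69 and A1jb / A1cs / A1qx / A1cx since v1.71 (critic idea-crit-3 g6 PASS — no price 20:33:05Z, RE-STAMPs REV 2 → REV 3 → REV 4 22:13:50Z; ref ns-census-ref g8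
PRE-CHECK ✓ §13.14 item 11 + items 19/20; lit §21.21 / §21.24 (a)); this port makes them TREE-decided): VERBATIM PORT of ns-idea-2 LINE g12-2 «temporal-spectrum»
REV 4, `pub/ideators/ns-idea-2/lines/temporal-spectrum/line-temporal-spectrum.lean` sha16 f2331f3a0765e1d4 (3431 l., lean check rc 0, 0 sorry), split for the
400-line rule into twelve parts `ScenarioCensusTemporalSpectrum{∅, Exponential, Oscillatory, OscillatoryRow, Jordan, Complex, ComplexDecay, ComplexRow, Quasi, QuasiGroup,
QuasiRow, Head}` (chain imports).  Lean text VERBATIM in namespace `…Theorems.ScenarioCensus.TemporalSpectrum` (the line's `…Lines.TemporalSpectrum` re-homed);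
port edits: the two `local notation "E3"` lines → one `abbrev E3` at namespace level and the bracket lines `section Rows` / `end Rows` dropped (no `variable`s
there; typer lint: no notation in port files), `@[conjecture]` on the OPEN head `Row_A1qp` (typed only), twenty-one one-line docstrings added (gate lint); the
lemmas the line shares VERBATIM with «mode-rank» / «floquet-meter» (§B spatial Liouville lemmas, the instrument `vortB` / `vortB_sum_sum`, the gauge
`tendsto_slice_atBot` / `eq_zero_of_curl_slice_const`, `laplacian_zero_apply`, `norm_curl_le_four_mul`) are taken BY NAME from those landed ports (listed
below); `tendsto_typeI_bound` (twin of a landed tree lemma in a module the farm does not build) is not re-declared and its four uses carry the one-line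
Mathlib proof inline (proof text only).  Statements untouched.

No census VALUE is moved here (row A1apT keeps its value; the members become TREE-decided by name); NS regularity is NOT proved; (L′) ⟨10661⟩ is
untouched; no summit statement is proved by this file. Lemmas that restate already-landed tree declarations are taken BY NAME (gate lint `dedup.landed`): `apply_eq_apply_of_harmonic_bounded` = `ModeRank.apply_eq_apply_of_harmonic_bounded`, `apply_eq_apply_of_curl_const` = `ModeRank.apply_eq_apply_of_curl_const`, `nonpos_of_laplacian_eq_mul` = `ModeRank.nonpos_of_laplacian_eq_mul`, `eq_zero_of_laplacian_eq_smul_of_pos` = `ModeRank.eq_zero_of_laplacian_eq_smul_of_pos`, `vortB` = `ModeRank.vortB`, `vortB_sum_sum` = `ModeRank.vortB_sum_sum`, `tendsto_slice_atBot` = `ModeRank.tendsto_slice_atBot`, `eq_zero_of_curl_slice_const` = `ModeRank.eq_zero_of_curl_slice_const`, `laplacian_zero_apply` = `ModeRank.laplacian_zero_fun`, `norm_curl_le_four_mul` = `FloquetMeter.norm_curl_le_four_mul`.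
-/

-- the summit and its single problem share the name `NavierStokesRegularity` (D-0017 nested layout)
set_option linter.dupNamespace false

noncomputable section

open Set Function Filter Topology

namespace Summit.NavierStokesRegularity.NavierStokesRegularity.Theorems.ScenarioCensus.TemporalSpectrum

open Literature.Analysis Literature.Analysis.FluidPDE InnerProductSpace
open Summit.NavierStokesRegularity.NavierStokesRegularity.Theorems (vorticity_eq_deriv_of_typeI)
open scoped Laplacian InnerProductSpace RealInnerProductSpace ContDiff

/-- Derivative of the trigonometric factors. -/
theorem hasDerivAt_csT {n : ℕ} (b : Fin n → ℝ) (μ : Fin n ⊕ Fin n) (t : ℝ) :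
    HasDerivAt (fun s => csT b s μ) (csD b t μ) t := by
  rcases μ with k | k
  · have hb1 : HasDerivAt (fun s => b k * s) (b k) t := by
      simpa using (hasDerivAt_id t).const_mul (b k)
    simp only [csT_inl, csD_inl]
    exact hb1.cos.congr_deriv (by ring)
  · have hb1 : HasDerivAt (fun s => b k * s) (b k) t := by
      simpa using (hasDerivAt_id t).const_mul (b k)
    simp only [csT_inr, csD_inr]
    exact hb1.sin

/-- The mode family of the quasi-polynomial ansatz on the index `(cos/sin, k) × (m < d)`. -/
def qΦ {n : ℕ} (d : ℕ) (ψ χ : Fin n → ℕ → E3 → E3) : (Fin n ⊕ Fin n) × Fin d → E3 → E3 :=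
  fun p => csΦ (fun k => ψ k (p.2 : ℕ)) (fun k => χ k (p.2 : ℕ)) p.1
/-- Its coefficients `e^{aₖt} t^m cos(bₖt)` / `e^{aₖt} t^m sin(bₖt)`. -/
def qc {n : ℕ} (d : ℕ) (a b : Fin n → ℝ) (t : ℝ) : (Fin n ⊕ Fin n) × Fin d → ℝ :=
  fun p => Real.exp (csν a p.1 * t) * (t ^ (p.2 : ℕ) * csT b t p.1)
/-- Their time derivatives. -/
def qc' {n : ℕ} (d : ℕ) (a b : Fin n → ℝ) (t : ℝ) : (Fin n ⊕ Fin n) × Fin d → ℝ :=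
  fun p => Real.exp (csν a p.1 * t) * (csν a p.1 * (t ^ (p.2 : ℕ) * csT b t p.1)
    + (((p.2 : ℕ) : ℝ) * t ^ ((p.2 : ℕ) - 1) * csT b t p.1 + t ^ (p.2 : ℕ) * csD b t p.1))

/-- `qΦ` on the left summand. -/
@[simp] theorem qΦ_inl {n : ℕ} (d : ℕ) (ψ χ : Fin n → ℕ → E3 → E3) (k : Fin n) (m : Fin d) :
    qΦ d ψ χ (Sum.inl k, m) = ψ k m := rfl
/-- `qΦ` on the right summand. -/
@[simp] theorem qΦ_inr {n : ℕ} (d : ℕ) (ψ χ : Fin n → ℕ → E3 → E3) (k : Fin n) (m : Fin d) :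
    qΦ d ψ χ (Sum.inr k, m) = χ k m := rfl
/-- Unfolding `qc`. -/
theorem qc_apply {n : ℕ} (d : ℕ) (a b : Fin n → ℝ) (t : ℝ) (p : (Fin n ⊕ Fin n) × Fin d) :
    qc d a b t p = Real.exp (csν a p.1 * t) * (t ^ (p.2 : ℕ) * csT b t p.1) := rfl
/-- Unfolding `qc'`. -/
theorem qc'_apply {n : ℕ} (d : ℕ) (a b : Fin n → ℝ) (t : ℝ) (p : (Fin n ⊕ Fin n) × Fin d) :
    qc' d a b t p = Real.exp (csν a p.1 * t) * (csν a p.1 * (t ^ (p.2 : ℕ) * csT b t p.1)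
      + (((p.2 : ℕ) : ℝ) * t ^ ((p.2 : ℕ) - 1) * csT b t p.1 + t ^ (p.2 : ℕ) * csD b t p.1)) := rfl

/-- The derivative of the quasi-polynomial coefficient `qc`. -/
theorem hasDerivAt_qc {n : ℕ} (d : ℕ) (a b : Fin n → ℝ) (p : (Fin n ⊕ Fin n) × Fin d) (t : ℝ) :
    HasDerivAt (fun s => qc d a b s p) (qc' d a b t p) t := by
  have he : HasDerivAt (fun s => Real.exp (csν a p.1 * s)) (Real.exp (csν a p.1 * t) * csν a p.1) t := by
    have h1 : HasDerivAt (fun s => csν a p.1 * s) (csν a p.1) t := by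
      simpa using (hasDerivAt_id t).const_mul (csν a p.1)
    simpa using h1.exp
  have hP : HasDerivAt (fun s => s ^ (p.2 : ℕ) * csT b s p.1)
      (((p.2 : ℕ) : ℝ) * t ^ ((p.2 : ℕ) - 1) * csT b t p.1 + t ^ (p.2 : ℕ) * csD b t p.1) t :=
    (hasDerivAt_pow (p.2 : ℕ) t).mul (hasDerivAt_csT b p.1 t)
  simp only [qc_apply, qc'_apply]
  exact (he.mul hP).congr_deriv (by ring)

/-- Group sums over the quasi-polynomial index collapse to sums over rates and powers. -/
theorem sum_filter_qType {n : ℕ} (d : ℕ) (a : Fin n → ℝ) (r : ℝ) (G : Fin n ⊕ Fin n → ℕ → E3) :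
    ∑ p ∈ Finset.univ.filter (fun p : (Fin n ⊕ Fin n) × Fin d => Sum.elim a a p.1 = r), G p.1 p.2
      = ∑ k ∈ Finset.univ.filter (fun k => a k = r), ∑ m ∈ Finset.range d,
          (G (Sum.inl k) m + G (Sum.inr k) m) := by
  classical
  have h1 : ∑ p ∈ Finset.univ.filter (fun p : (Fin n ⊕ Fin n) × Fin d => Sum.elim a a p.1 = r),
      G p.1 p.2 = ∑ μ ∈ Finset.univ.filter (fun μ : Fin n ⊕ Fin n => Sum.elim a a μ = r),
        ∑ m : Fin d, G μ m := by
    rw [Finset.sum_filter, Finset.sum_filter, Fintype.sum_prod_type]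
    refine Finset.sum_congr rfl fun μ _ => ?_
    split_ifs with hμ
    · rfl
    · simp
  rw [h1, sum_filter_sumType]
  refine Finset.sum_congr rfl fun k _ => ?_
  have e1 : ∑ m : Fin d, G (Sum.inl k) m = ∑ m ∈ Finset.range d, G (Sum.inl k) m :=
    Fin.sum_univ_eq_sum_range (fun m => G (Sum.inl k) m) d
  have e2 : ∑ m : Fin d, G (Sum.inr k) m = ∑ m ∈ Finset.range d, G (Sum.inr k) m :=
    Fin.sum_univ_eq_sum_range (fun m => G (Sum.inr k) m) d
  rw [e1, e2, ← Finset.sum_add_distrib]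

/-- `e^{-rt} e^{νt} c = e^{(ν-r)t} c`. -/
theorem exp_weight_mul (r ν t c : ℝ) :
    Real.exp (-(r * t)) * (Real.exp (ν * t) * c) = Real.exp ((ν - r) * t) * c := by
  rw [← mul_assoc, ← Real.exp_add]
  congr 2
  ring

/-- **Step 1 of Row A1qx: modes of non-positive real part vanish.** -/
theorem q_decay {C : ℝ} {u : ℝ → E3 → E3} (hu : IsTypeIAncientMild C u) {n d : ℕ}
    {a b : Fin n → ℝ} {ψ χ : Fin n → ℕ → E3 → E3} (hb0 : ∀ k, 0 ≤ b k)
    (hinj : Function.Injective (fun k => (a k, b k)))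
    (hsl' : ∀ s < 0, ∀ y, u s y = ∑ p, qc d a b s p • qΦ d ψ χ p y) :
    ∀ k, a k ≤ 0 → ∀ m < d, (∀ x, ψ k m x = 0) ∧ (b k ≠ 0 → ∀ x, χ k m x = 0) := by
  classical
  by_contra hcon
  obtain ⟨k₁, hk₁⟩ := not_forall.1 hcon
  set S : Finset (Fin n) := Finset.univ.filter (fun k =>
    ¬ (a k ≤ 0 → ∀ m < d, (∀ x, ψ k m x = 0) ∧ (b k ≠ 0 → ∀ x, χ k m x = 0))) with hS
  have hSne : S.Nonempty :=
    ⟨k₁, by simp only [hS, Finset.mem_filter, Finset.mem_univ, true_and]; exact hk₁⟩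
  obtain ⟨k₀, hk₀S, hmin⟩ := S.exists_min_image a hSne
  have hk₀ := (Finset.mem_filter.1 hk₀S).2
  rw [Classical.not_imp] at hk₀
  obtain ⟨hr0, hbad⟩ := hk₀
  have hgood : ∀ k, a k < a k₀ → ∀ m < d, (∀ x, ψ k m x = 0) ∧ (b k ≠ 0 → ∀ x, χ k m x = 0) := by
    intro k hk
    by_contra hk'
    have hkS : k ∈ S := by
      simp only [hS, Finset.mem_filter, Finset.mem_univ, true_and, Classical.not_imp]
      exact ⟨by linarith, hk'⟩
    exact absurd (hmin k hkS) (not_le.2 hk)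
  apply hbad
  have hgrp : ∀ x, Tendsto (fun t : ℝ => ∑ k ∈ Finset.univ.filter (fun k => a k = a k₀),
      ∑ m ∈ Finset.range d, t ^ m • (Real.cos (b k * t) • ψ k m x + Real.sin (b k * t) • χ k m x))
      atBot (𝓝 0) := by
    intro x
    have G := tendsto_filter_of_tendsto
      (fun p : (Fin n ⊕ Fin n) × Fin d => Sum.elim a a p.1 = a k₀)
      (fun p t => Real.exp (-(a k₀ * t)) • (qc d a b t p • qΦ d ψ χ p x))
      (by
        rintro ⟨μ, m⟩ hp
        rcases lt_or_gt_of_ne hp with hlt | hgt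
        · -- an invisible velocity mode
          refine tendsto_const_nhds.congr fun t => ?_
          symm
          rcases μ with k | k
          · simp only [Sum.elim_inl] at hlt
            rw [qΦ_inl, (hgood k hlt m m.isLt).1 x, smul_zero, smul_zero]
          · simp only [Sum.elim_inr] at hlt
            by_cases hbk : b k = 0
            · simp [qc_apply, csT_inr, hbk]
            · rw [qΦ_inr, (hgood k hlt m m.isLt).2 hbk x, smul_zero, smul_zero]
        · -- a decaying weight
          have hε : 0 < Sum.elim a a μ - a k₀ := sub_pos.2 hgt
          have T := tendsto_expPoly_smul hε (m : ℕ) (fun t => csT b t μ) 1 (fun t => abs_csT_le b t μ)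
            (fun _ => qΦ d ψ χ (μ, m) x) ‖qΦ d ψ χ (μ, m) x‖ (fun _ => le_rfl)
          refine T.congr fun t => ?_
          rw [smul_smul, qc_apply]
          congr 1
          change Real.exp ((csν a μ - a k₀) * t) * t ^ (m : ℕ) * csT b t μ
            = Real.exp (-(a k₀ * t)) * (Real.exp (csν a μ * t) * (t ^ (m : ℕ) * csT b t μ))
          rw [exp_weight_mul]; ring)
      (by
        have h1 : Tendsto (fun t : ℝ => Real.exp (-(a k₀ * t)) • u t x) atBot (𝓝 0) := by
          refine squeeze_zero_norm' ?_ ((show Tendsto (fun s : ℝ => C / Real.sqrt (-s)) atBot (𝓝 0) from (Real.tendsto_sqrt_atTop.comp tendsto_neg_atBot_atTop).const_div_atTop C))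
          filter_upwards [Iio_mem_atBot (0 : ℝ)] with t ht
          have he1 : Real.exp (-(a k₀ * t)) ≤ 1 :=
            Real.exp_le_one_iff.2 (neg_nonpos.2 (mul_nonneg_of_nonpos_of_nonpos hr0 (le_of_lt ht)))
          rw [norm_smul, Real.norm_eq_abs, abs_of_pos (Real.exp_pos _)]
          exact (mul_le_of_le_one_left (norm_nonneg _) he1).trans (hu.norm_le ht x)
        refine h1.congr' ?_
        filter_upwards [Iio_mem_atBot (0 : ℝ)] with t ht
        rw [hsl' t ht x, Finset.smul_sum])
    refine G.congr fun t => ?_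
    have e1 : ∑ p ∈ Finset.univ.filter (fun p : (Fin n ⊕ Fin n) × Fin d => Sum.elim a a p.1 = a k₀),
        Real.exp (-(a k₀ * t)) • (qc d a b t p • qΦ d ψ χ p x)
        = ∑ p ∈ Finset.univ.filter (fun p : (Fin n ⊕ Fin n) × Fin d => Sum.elim a a p.1 = a k₀),
          (t ^ (p.2 : ℕ) * csT b t p.1) • csΦ (fun k => ψ k p.2) (fun k => χ k p.2) p.1 x := by
      refine Finset.sum_congr rfl fun p hp => ?_
      have hp' : csν a p.1 = a k₀ := (Finset.mem_filter.1 hp).2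
      rw [smul_smul, qc_apply, hp', ← mul_assoc, ← Real.exp_add, neg_add_cancel, Real.exp_zero,
        one_mul]
      rfl
    rw [e1, sum_filter_qType d a (a k₀)
      (fun μ m => (t ^ m * csT b t μ) • csΦ (fun k => ψ k m) (fun k => χ k m) μ x)]
    refine Finset.sum_congr rfl fun k _ => Finset.sum_congr rfl fun m _ => ?_
    simp only [csT_inl, csT_inr, csΦ_inl, csΦ_inr, smul_add, smul_smul]
  have hInj : Set.InjOn b ↑(Finset.univ.filter (fun k => a k = a k₀)) := by
    intro k hk k' hk' hbb
    simp only [Finset.coe_filter, Finset.mem_univ, true_and, Set.mem_setOf_eq] at hk hk'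
    exact hinj (Prod.ext (by simp [hk, hk']) hbb)
  have hk₀mem : k₀ ∈ Finset.univ.filter (fun k => a k = a k₀) := by simp
  have key := fun x => quasiPoly_coeff_eq_zero (Finset.univ.filter (fun k => a k = a k₀)) b
    (fun k _ => hb0 k) hInj d (fun k m => ψ k m x) (fun k m => χ k m x) (hgrp x) k₀ hk₀mem
  intro m hm
  exact ⟨fun x => (key x m hm).1, fun hb x => (key x m hm).2 hb⟩

/-- **Step 2 of Row A1qx: the vorticity equation along the quasi-polynomial modes.** -/
theorem q_identity {C : ℝ} {u : ℝ → E3 → E3} (hu : IsTypeIAncientMild C u) {n d : ℕ}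
    {a b : Fin n → ℝ} {ψ χ : Fin n → ℕ → E3 → E3} (hψ : ∀ k m, ContDiff ℝ 3 (ψ k m))
    (hχ : ∀ k m, ContDiff ℝ 3 (χ k m))
    (hsl' : ∀ s < 0, ∀ y, u s y = ∑ p, qc d a b s p • qΦ d ψ χ p y) :
    ∀ t < 0, ∀ x,
      ∑ p, qc' d a b t p • curl (qΦ d ψ χ p) x
        + ∑ p, ∑ q, (qc d a b t p * qc d a b t q) • ModeRank.vortB (qΦ d ψ χ p) (curl (qΦ d ψ χ q)) x
        - ∑ p, qc d a b t p • (Δ (curl (qΦ d ψ χ p))) x = 0 := by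
  classical
  have hΦ : ∀ p, ContDiff ℝ 3 (qΦ d ψ χ p) := by
    rintro ⟨k | k, m⟩
    · exact hψ k m
    · exact hχ k m
  have hcΦ : ∀ p, ContDiff ℝ 2 (curl (qΦ d ψ χ p)) := fun p => contDiff_curl (hΦ p)
  have hdΦ : ∀ p, Differentiable ℝ (qΦ d ψ χ p) := fun p => (hΦ p).differentiable (by norm_num)
  have hslF : ∀ s < 0, u s = fun y => ∑ p, qc d a b s p • qΦ d ψ χ p y :=
    fun s hs => funext (hsl' s hs)
  have hcurl : ∀ s < 0, curl (u s) = fun y => ∑ p, qc d a b s p • curl (qΦ d ψ χ p) y := by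
    intro s hs; funext y; rw [hslF s hs]; exact curl_sum_smul' hdΦ _ y
  intro t ht x
  have h2 := vorticity_eq_deriv_of_typeI hu ht x
  have hd : deriv (fun s => curl (u s) x) t = ∑ p, qc' d a b t p • curl (qΦ d ψ χ p) x := by
    have hev : (fun s => curl (u s) x) =ᶠ[𝓝 t]
        fun s => ∑ p, qc d a b s p • curl (qΦ d ψ χ p) x := by
      filter_upwards [Iio_mem_nhds ht] with s hs
      rw [hcurl s hs]
    rw [hev.deriv_eq]
    exact (hasDerivAt_sum_smul' (c := fun s p => qc d a b s p) (c' := fun p => qc' d a b t p)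
      (fun p => curl (qΦ d ψ χ p) x) fun p => hasDerivAt_qc d a b p t).deriv
  have hB : fderiv ℝ (curl (u t)) x (u t x) - fderiv ℝ (u t) x (curl (u t) x)
      = ∑ p, ∑ q, (qc d a b t p * qc d a b t q) • ModeRank.vortB (qΦ d ψ χ p) (curl (qΦ d ψ χ q)) x := by
    have := ModeRank.vortB_sum_sum (qΦ d ψ χ) (fun q => curl (qΦ d ψ χ q)) (qc d a b t) (qc d a b t)
      (x := x) (fun l => hdΦ l x) (fun q => (hcΦ q).differentiable (by norm_num) x)
    rw [hcurl t ht, hslF t ht]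
    simpa only [ModeRank.vortB] using this
  have hL : (Δ (curl (u t))) x = ∑ p, qc d a b t p • (Δ (curl (qΦ d ψ χ p))) x := by
    rw [hcurl t ht]; exact laplacian_sum_smul' hcΦ _ x
  have h3 : deriv (fun s => curl (u s) x) t
      + (fderiv ℝ (curl (u t)) x (u t x) - fderiv ℝ (u t) x (curl (u t) x))
      - (Δ (curl (u t))) x = 0 := by rw [← sub_eq_zero.2 h2]; abel
  rw [hd, hB, hL] at h3
  exact h3

/-- Cosine coefficient of `t^m` for rate `k` in the linear part, Jordan coupling included:
`aₖ ωψₖₘ + bₖ ωχₖₘ + (m+1) ωψₖ,ₘ₊₁ - Δωψₖₘ`. -/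
def qX {n : ℕ} (a b : Fin n → ℝ) (ψ χ : Fin n → ℕ → E3 → E3) (x : E3) (k : Fin n) (m : ℕ) : E3 :=
  a k • curl (ψ k m) x + b k • curl (χ k m) x + ((m : ℝ) + 1) • curl (ψ k (m + 1)) x
    - (Δ (curl (ψ k m))) x
/-- Sine coefficient: `aₖ ωχₖₘ - bₖ ωψₖₘ + (m+1) ωχₖ,ₘ₊₁ - Δωχₖₘ`. -/
def qY {n : ℕ} (a b : Fin n → ℝ) (ψ χ : Fin n → ℕ → E3 → E3) (x : E3) (k : Fin n) (m : ℕ) : E3 :=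
  a k • curl (χ k m) x - b k • curl (ψ k m) x + ((m : ℝ) + 1) • curl (χ k (m + 1)) x
    - (Δ (curl (χ k m))) x

/-- Unfolding `qX`. -/
theorem qX_apply {n : ℕ} (a b : Fin n → ℝ) (ψ χ : Fin n → ℕ → E3 → E3) (x : E3) (k : Fin n)
    (m : ℕ) : qX a b ψ χ x k m = a k • curl (ψ k m) x + b k • curl (χ k m) x
      + ((m : ℝ) + 1) • curl (ψ k (m + 1)) x - (Δ (curl (ψ k m))) x := rfl
/-- Unfolding `qY`. -/
theorem qY_apply {n : ℕ} (a b : Fin n → ℝ) (ψ χ : Fin n → ℕ → E3 → E3) (x : E3) (k : Fin n)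
    (m : ℕ) : qY a b ψ χ x k m = a k • curl (χ k m) x - b k • curl (ψ k m) x
      + ((m : ℝ) + 1) • curl (χ k (m + 1)) x - (Δ (curl (χ k m))) x := rfl

end Summit.NavierStokesRegularity.NavierStokesRegularity.Theorems.ScenarioCensus.TemporalSpectrum

end
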